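import Literature.NumberTheory.Automorphic.AutomorphicRepsGLSatakeFlathProofs
import HarnessLib

/-!
# Lie derivatives of `K`-finite functions are `K`-finite

Topic `NumberTheory/Automorphic`. For a linear real group `H` (`𝔤 = H.lie`, `K = H.maximalCompact`)
over a finite-dimensional coefficient algebra, a homomorphism `ι : H → G` and a function
`φ : G → ℂ` whose right `K`-translates are smooth in the archimedean variable and span a
finite-dimensional space `V` (`IsKFinite ι φ`), every Lie derivative `X φ`, `X ∈ 𝔤`, is again
`K`-finite (Borel–Jacquet 1979, §1.3 and 4.3 (ii); Borel 1997, 2.16; Bump 1997, §3.3, Exercise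
3.3.2: "if `f` is `K`-finite then `X f` is `K`-finite"): by `Ad`-equivariance
`r(k) (X φ) = (Ad k X) (r(k) φ)` (`archTranslate_lieDeriv`, tree) every `K`-translate of `X φ` lies
in the finite-dimensional space spanned by the `Yᵢ ψⱼ`, `(Yᵢ)` a basis of `𝔤` and `(ψⱼ)` a basis
of `V`, using the bilinearity of `(Y, ψ) ↦ Y ψ` on smooth `ψ` (`IsArchSmooth.lieDeriv_sum_smul_left`,
`IsArchSmooth.lieDeriv_add`, tree).

* `IsArchSmooth.lieDeriv_finset_sum_smul` — `Y (∑ cⱼ ψⱼ) = ∑ cⱼ (Y ψⱼ)` for smooth `ψⱼ`;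
* `isKFinite_lieDeriv` — the statement above (hypotheses: the `K`-translates of `φ` are smooth, and
  `φ` is `K`-finite).

Everything here is proved; no definitions. (Smoothness of the `K`-translates holds for every
archimedean-smooth `φ`, `isArchSmooth_archTranslate` of `AutomorphicFormsKTranslates`; it is kept
as a hypothesis here to keep the imports minimal.)

## References

* A. Borel, H. Jacquet, *Automorphic forms and automorphic representations*, Proc. Sympos. Pure
  Math. 33 (1979), part 1, §1.3, 4.3 (ii) [BorelJacquet1979].
* A. Borel, *Automorphic forms on `SL₂(ℝ)`* (1997), 2.16 [Borel1997].
* D. Bump, *Automorphic Forms and Representations* (1997), §3.3, Exercise 3.3.2 (PDF p. 292)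
  [Bump1997].
-/

noncomputable section

open scoped MatrixGroups Matrix ContDiff

namespace Literature.NumberTheory.Automorphic

variable {A : Type*} [NormedCommRing A] [NormedAlgebra ℝ A] [NormedAlgebra ℚ A] [CompleteSpace A]
  [StarRing A] {N : Type*} [Fintype N] [DecidableEq N] {H : RealMatrixGroup A N}
  {G : Type*} [Group G] (ι : H.carrier →* G)

/-- **Lie derivatives of finite linear combinations of smooth functions**:
`Y (∑ⱼ cⱼ ψⱼ) = ∑ⱼ cⱼ (Y ψⱼ)` when every `ψⱼ` is smooth in the archimedean variable (additivity of
`Y` needs smoothness; `IsArchSmooth.lieDeriv_add`, `lieDeriv_smul`).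
Borel–Jacquet 1979, §1.5. [cite: BorelJacquet1979, §1.5] -/
theorem IsArchSmooth.lieDeriv_finset_sum_smul (Y : H.lie) {J : Type*} (s : Finset J) (c : J → ℂ)
    {ψ : J → G → ℂ} (hψ : ∀ j, IsArchSmooth ι (ψ j)) :
    lieDeriv ι Y (∑ j ∈ s, c j • ψ j) = ∑ j ∈ s, c j • lieDeriv ι Y (ψ j) := by
  classical
  induction s using Finset.induction_on with
  | empty => simp
  | insert a s ha ih =>
    rw [Finset.sum_insert ha, Finset.sum_insert ha,
      IsArchSmooth.lieDeriv_add ι Y ((hψ a).smul ι (c a)) ?_, lieDeriv_smul, ih]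
    exact (archSmooth ι).sum_mem fun j _ => (hψ j).smul ι (c j)

/-- **Lie derivatives of `K`-finite functions are `K`-finite** (Borel–Jacquet 1979, §1.3 and
4.3 (ii); Borel 1997, 2.16; Bump 1997, Exercise 3.3.2), for a finite-dimensional coefficient
algebra: if the right `K`-translates `r(k) φ` of `φ` are smooth in the archimedean variable and
span a finite-dimensional space `V`, then for every `X ∈ 𝔤` the `K`-translates
`r(k) (X φ) = (Ad k X) (r(k) φ)` of `X φ` lie in the span of the finitely many functions `Yᵢ ψⱼ`
(`Yᵢ` a basis of `𝔤`, `ψⱼ` a basis of `V`), so `X φ` is `K`-finite. [cite: BorelJacquet1979, 4.3 (ii)] -/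
theorem isKFinite_lieDeriv [FiniteDimensional ℝ A] {φ : G → ℂ}
    (hsmooth : ∀ k : H.maximalCompact,
      IsArchSmooth ι (archTranslate ι (Subgroup.inclusion H.maximalCompact_le_carrier k) φ))
    (hK : IsKFinite ι φ) (X : H.lie) : IsKFinite ι (lieDeriv ι X φ) := by
  classical
  letI : LieRing (Matrix N N A) := LieRing.ofAssociativeRing
  -- the finite-dimensional span `V` of the `K`-translates of `φ`; its elements are smooth
  set V : Submodule ℂ (G → ℂ) := kTranslateSpan ι φ with hV_def
  haveI : FiniteDimensional ℂ V := hK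
  have hVsmooth : ∀ ψ ∈ V, IsArchSmooth ι ψ := by
    intro ψ hψ
    refine (Submodule.span_le (p := archSmooth ι)).2 ?_ hψ
    rintro _ ⟨k, rfl⟩
    exact hsmooth k
  -- bases of `V` and of `𝔤`
  let d : ℕ := Module.finrank ℂ V
  let bV := Module.finBasis ℂ V
  haveI : FiniteDimensional ℝ H.lie :=
    inferInstanceAs (FiniteDimensional ℝ H.lie.toSubmodule)
  let m : ℕ := Module.finrank ℝ H.lie
  let b𝔤 := Module.finBasis ℝ H.lie
  -- the finite-dimensional target space `T = span {Yᵢ ψⱼ}`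
  set T : Submodule ℂ (G → ℂ) := Submodule.span ℂ
    (Set.range fun p : Fin m × Fin d => lieDeriv ι (b𝔤 p.1) (bV p.2 : G → ℂ)) with hT_def
  haveI : FiniteDimensional ℂ T := FiniteDimensional.span_of_finite ℂ (Set.finite_range _)
  -- every Lie derivative of every element of `V` lies in `T`
  have hbasis : ∀ (Y : H.lie) (j : Fin d), lieDeriv ι Y (bV j : G → ℂ) ∈ T := by
    intro Y j
    rw [← b𝔤.sum_repr Y, (hVsmooth _ (bV j).2).lieDeriv_sum_smul_left ι]
    refine Submodule.sum_mem _ fun i _ => ?_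
    rw [← algebraMap_smul ℂ (b𝔤.repr Y i)]
    exact Submodule.smul_mem _ _ (Submodule.subset_span ⟨(i, j), rfl⟩)
  have hVT : ∀ (Y : H.lie), ∀ ψ ∈ V, lieDeriv ι Y ψ ∈ T := by
    intro Y ψ hψ
    have hrepr : ψ = ∑ j, (bV.repr ⟨ψ, hψ⟩ j) • (bV j : G → ℂ) := by
      conv_lhs => rw [show ψ = ((⟨ψ, hψ⟩ : V) : G → ℂ) from rfl, ← bV.sum_repr ⟨ψ, hψ⟩]
      rw [Submodule.coe_sum]
      rfl
    rw [hrepr, IsArchSmooth.lieDeriv_finset_sum_smul ι Y _ _ fun j => hVsmooth _ (bV j).2]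
    exact Submodule.sum_mem _ fun j _ => Submodule.smul_mem _ _ (hbasis Y j)
  -- the `K`-translates of `X φ` lie in `T`
  unfold IsKFinite
  refine Submodule.finiteDimensional_of_le (S₂ := T) (Submodule.span_le.2 ?_)
  rintro _ ⟨k, rfl⟩
  dsimp only
  rw [SetLike.mem_coe, archTranslate_lieDeriv]
  exact hVT _ _ (archTranslate_mem_kTranslateSpan ι k φ)

end Literature.NumberTheory.Automorphic
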